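import Mathlib
import HarnessLib
import Summits.HubbardSuperconductivity.HubbardSuperconductivity.Theorems.KLProgrammeKLRegimeWickCrossContractionTailPushforward

/-!
# Route `KLProgramme` — ENGINE child gen 8 (stmt-HubbardSuperconductivity-20437 `KLRegimeEngineV17F2`), stub (c) v2 class #3 (E.5 share), PROVING side:
# PUSH-FORWARD of two-vertex line terms to the physical fields, HYBRID form (entry bound × admissible labels × one free translation)
# (cell gate-hubbard-kl, seat p5 g8; the hybrid twin of `…WickCrossContractionTailPushforward` (p533230); cure of FINDING (E5-VOL))

`…TailPushforward.norm_kernel_dblFold_crossLaplacian_sum_pow_map_le` bounds a kernel of the push-forward `map M` by `R^m · (sup over the sector-field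
tuple)`, `R` the ROW sums of `‖M‖` — for the sector substitution `R = ρ₁·|SpaceTimeIdx|/(βL²)`, which loses the volume (FINDING (E5-VOL)).  Here the
ENTRIES of `M` are bounded (`‖M a b‖ ≤ B`, for the sector substitution `B = (βL²)⁻¹`), the LABEL of each source leg is restricted to the admissible set
`Adm a` of the target leg (`M a b ≠ 0 ⇒ b.2 ∈ Adm a`; `≤ ρ₁` sectors contain a given momentum), and the source POSITIONS are summed with ONE leg pinned
(the free translation costs `|P|`):

* §1 `norm_kernel_map_le_of_entry_labels` — `‖kernel (map M F) m X′‖ ≤ B^m · Σ_{σ ∈ Π_i Adm(X′ i)} Σ_{Y : labels σ} ‖kernel F m Y‖`;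
* §2 `sum_filter_labels_le_card_mul_of_pinned` (pinning one leg: `Σ_{Y : labels σ} f ≤ |P| · sup_x Σ_{Y : Y p = (x, σ p), labels σ} f`) and
  **`norm_kernel_dblFold_crossLaplacian_sum_pow_map_le_of_hybridTails`** — for a weighted sum of two-vertex line terms behind one distinguished line:
  `‖kernel(dblFold(Δ_×(g)((Σ_{i∈S} c_i • Δ_×(D)^i)((map M a′)⁰(map M b′)¹)))) m X′‖ ≤ B^m · (∏_i #Adm(X′ i)) · |P| · Σ_s T s`, given per-colouring HYBRID
  tails `Σ_{i∈S} ‖c_i‖ · Σ_{Y : Y (p s) = (x, σ (p s)), labels σ} ‖kernel((Δ_×(MᵀDM)^i·Δ_×(MᵀgM))(a′⁰b′¹)) m (Y,s)‖ ≤ T s` uniformly in the admissible `σ`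
  and the pinned position `x` (exactly what `…GramTailHybrid` supplies at `k = i + 1`).

Pure algebra / triangle inequality; no definitions, no named facts, nothing about the model.
-/

noncomputable section

namespace Summit.HubbardSuperconductivity.HubbardSuperconductivity.Theorems.KLRegimeWick

set_option linter.dupNamespace false -- summit = problem name (single-conjunct summit), D-0017

open Literature.MathematicalPhysics.QuantumLattice GrassmannAlgebra Finset Matrix
open scoped Kronecker

/-! ## §1 Kernels of a push-forward: entry bound × admissible labels -/

section Entry

variable {P S Γ' : Type*} [Fintype P] [Fintype S] [DecidableEq P] [DecidableEq S]

/-- **Kernels of a push-forward, HYBRID form**: if every entry of the substitution matrix is `≤ B` in norm and a nonzero entry `M a b` forces the label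
`b.2` into the admissible set `Adm a`, then `‖kernel (map M F) m X′‖ ≤ B^m · Σ_{σ ∈ Π_i Adm (X′ i)} Σ_{Y : (Y j).2 = σ j ∀ j} ‖kernel F m Y‖`. [folklore] -/
theorem norm_kernel_map_le_of_entry_labels (Mx : Matrix Γ' (P × S) ℂ) (F : GrassmannAlgebra ℂ (P × S)) (m : ℕ) (X' : Fin m → Γ')
    {B : ℝ} (hB0 : 0 ≤ B) (hM : ∀ a b, ‖Mx a b‖ ≤ B) (Adm : Γ' → Finset S) (hAdm : ∀ a b, Mx a b ≠ 0 → b.2 ∈ Adm a) :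
    ‖kernel ℂ (ExteriorAlgebra.map (Matrix.toLin' Mx) F) m X'‖ ≤
      B ^ m * ∑ σ ∈ Fintype.piFinset (fun i => Adm (X' i)),
        ∑ Y ∈ univ.filter (fun Y : Fin m → P × S => ∀ j, (Y j).2 = σ j), ‖kernel ℂ F m Y‖ := by
  classical
  rw [kernel_map, LinearMap.toMatrix'_toLin']
  set Good : Finset (Fin m → P × S) := univ.filter fun Y => ∀ j, (Y j).2 ∈ Adm (X' j) with hGood
  -- the terms outside `Good` vanish
  have hvan : ∑ Y : Fin m → P × S, (∏ i, Mx (X' i) (Y i)) * kernel ℂ F m Y = ∑ Y ∈ Good, (∏ i, Mx (X' i) (Y i)) * kernel ℂ F m Y := by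
    refine (sum_subset (filter_subset _ _) fun Y _ hY => ?_).symm
    have hY' : ¬ ∀ j, (Y j).2 ∈ Adm (X' j) := fun h => hY (mem_filter.2 ⟨mem_univ _, h⟩)
    obtain ⟨j, hj⟩ := not_forall.1 hY'
    have h0 : Mx (X' j) (Y j) = 0 := by
      by_contra h
      exact hj (hAdm _ _ h)
    rw [prod_eq_zero (mem_univ j) h0, zero_mul]
  rw [hvan]
  -- entry bound
  have hent : ∀ Y, ‖(∏ i, Mx (X' i) (Y i)) * kernel ℂ F m Y‖ ≤ B ^ m * ‖kernel ℂ F m Y‖ := by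
    intro Y
    rw [norm_mul, norm_prod]
    refine mul_le_mul_of_nonneg_right ?_ (norm_nonneg _)
    calc ∏ i, ‖Mx (X' i) (Y i)‖ ≤ ∏ _i : Fin m, B := prod_le_prod (fun i _ => norm_nonneg _) fun i _ => hM _ _
      _ = B ^ m := by rw [prod_const, card_univ, Fintype.card_fin]
  refine (norm_sum_le _ _).trans ((sum_le_sum fun Y _ => hent Y).trans ?_)
  rw [← mul_sum]
  refine mul_le_mul_of_nonneg_left ?_ (pow_nonneg hB0 m)
  -- fibre by the label tuple
  rw [← sum_fiberwise_of_maps_to (s := Good) (t := Fintype.piFinset fun i => Adm (X' i)) (g := fun Y : Fin m → P × S => fun j => (Y j).2)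
    (fun Y hY => Fintype.mem_piFinset.2 (mem_filter.1 hY).2)]
  refine sum_le_sum fun σ _ => sum_le_sum_of_subset_of_nonneg (fun Y hY => ?_) fun _ _ _ => norm_nonneg _
  rw [mem_filter] at hY
  exact mem_filter.2 ⟨mem_univ _, fun j => congrFun hY.2 j⟩

end Entry

/-! ## §2 One leg pinned; through the fold and a weighted sum of line terms -/

section Pinned

variable {P S : Type*} [Fintype P] [Fintype S] [DecidableEq P] [DecidableEq S]

/-- **Pinning one leg**: with the labels fixed, the sum over all positions is at most `|P|` times the largest sum with leg `p` pinned. [folklore] -/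
theorem sum_filter_labels_le_card_mul_of_pinned {m : ℕ} (f : (Fin m → P × S) → ℝ) (hf : ∀ Y, 0 ≤ f Y) (σ : Fin m → S) (p : Fin m) {H : ℝ}
    (hH : ∀ x : P, ∑ Y ∈ univ.filter (fun Y : Fin m → P × S => Y p = (x, σ p) ∧ ∀ j, (Y j).2 = σ j), f Y ≤ H) :
    ∑ Y ∈ univ.filter (fun Y : Fin m → P × S => ∀ j, (Y j).2 = σ j), f Y ≤ Fintype.card P * H := by
  classical
  rw [← sum_fiberwise_of_maps_to (s := univ.filter (fun Y : Fin m → P × S => ∀ j, (Y j).2 = σ j)) (t := (univ : Finset P))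
    (g := fun Y : Fin m → P × S => (Y p).1) (fun Y _ => mem_univ _)]
  calc ∑ x : P, ∑ Y ∈ (univ.filter (fun Y : Fin m → P × S => ∀ j, (Y j).2 = σ j)).filter (fun Y => (Y p).1 = x), f Y
      ≤ ∑ _x : P, H := sum_le_sum fun x _ => by
        refine le_trans (sum_le_sum_of_subset_of_nonneg (fun Y hY => ?_) fun _ _ _ => hf _) (hH x)
        simp only [mem_filter, mem_univ, true_and] at hY ⊢
        exact ⟨Prod.ext hY.2 (hY.1 p), hY.1⟩
    _ = Fintype.card P * H := by rw [sum_const, card_univ, nsmul_eq_mul]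

variable {Γ' : Type*} [Fintype Γ'] [DecidableEq Γ']

/-- **Push-forward of a weighted sum of two-vertex line terms, HYBRID form**: entries of `M` bounded by `B`, admissible label sets `Adm`, one output leg
`p s` pinned per colouring `s`; per-colouring hybrid tails `T s` (uniform in the admissible label tuple `σ` and the pinned position `x`):
`‖kernel(dblFold(Δ_×(g)((Σ_{i∈S} c_i • Δ_×(D)^i)((map M a′)⁰(map M b′)¹)))) m X′‖ ≤ B^m · ((∏_i #Adm(X′ i)) · (|P| · Σ_s T s))`. [folklore] -/
theorem norm_kernel_dblFold_crossLaplacian_sum_pow_map_le_of_hybridTails (Mx : Matrix Γ' (P × S) ℂ) (g D : Matrix Γ' Γ' ℂ) (Sset : Finset ℕ)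
    (c : ℕ → ℂ) (a' b' : GrassmannAlgebra ℂ (P × S)) {m : ℕ} (X' : Fin m → Γ') {B : ℝ} (hB0 : 0 ≤ B) (hM : ∀ a b, ‖Mx a b‖ ≤ B)
    (Adm : Γ' → Finset S) (hAdm : ∀ a b, Mx a b ≠ 0 → b.2 ∈ Adm a) (p : (Fin m → Fin 2) → Fin m)
    (T : (Fin m → Fin 2) → ℝ)
    (hT : ∀ (s : Fin m → Fin 2) (σ : Fin m → S) (x : P), (∀ j, σ j ∈ Adm (X' j)) →
      ∑ i ∈ Sset, ‖c i‖ * ∑ Y ∈ univ.filter (fun Y : Fin m → P × S => Y (p s) = (x, σ (p s)) ∧ ∀ j, (Y j).2 = σ j),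
        ‖kernel ℂ ((grassmannLaplacian ℂ (crossCov ℂ (Mx.transpose * D * Mx)) ^ i * grassmannLaplacian ℂ (crossCov ℂ (Mx.transpose * g * Mx)))
          (dblCopy ℂ 0 a' * dblCopy ℂ 1 b')) m (fun j => (Y j, s j))‖ ≤ T s) :
    ‖kernel ℂ (dblFold ℂ (grassmannLaplacian ℂ (crossCov ℂ g)
        ((∑ i ∈ Sset, c i • grassmannLaplacian ℂ (crossCov ℂ D) ^ i)
          (dblCopy ℂ 0 (ExteriorAlgebra.map (Matrix.toLin' Mx) a') * dblCopy ℂ 1 (ExteriorAlgebra.map (Matrix.toLin' Mx) b'))))) m X'‖ ≤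
      B ^ m * ((∏ i, ((Adm (X' i)).card : ℝ)) * (Fintype.card P * ∑ s : Fin m → Fin 2, T s)) := by
  classical
  -- notation for the sector-field terms
  set K : ℕ → (Fin m → Fin 2) → (Fin m → P × S) → ℝ := fun i s Y =>
    ‖kernel ℂ ((grassmannLaplacian ℂ (crossCov ℂ (Mx.transpose * D * Mx)) ^ i * grassmannLaplacian ℂ (crossCov ℂ (Mx.transpose * g * Mx)))
      (dblCopy ℂ 0 a' * dblCopy ℂ 1 b')) m (fun j => (Y j, s j))‖ with hK
  have hK0 : ∀ i s Y, 0 ≤ K i s Y := fun i s Y => norm_nonneg _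
  -- (1) per term `i`: push forward and unfold the fold
  have hterm : ∀ i ∈ Sset, ‖kernel ℂ (dblFold ℂ (grassmannLaplacian ℂ (crossCov ℂ g)
      ((c i • grassmannLaplacian ℂ (crossCov ℂ D) ^ i)
        (dblCopy ℂ 0 (ExteriorAlgebra.map (Matrix.toLin' Mx) a') * dblCopy ℂ 1 (ExteriorAlgebra.map (Matrix.toLin' Mx) b'))))) m X'‖ ≤
      ‖c i‖ * (B ^ m * ∑ σ ∈ Fintype.piFinset (fun j => Adm (X' j)), ∑ s : Fin m → Fin 2,
        ∑ Y ∈ univ.filter (fun Y : Fin m → P × S => ∀ j, (Y j).2 = σ j), K i s Y) := by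
    intro i _
    rw [LinearMap.smul_apply, map_smul, map_smul, kernel_smul, norm_mul, dblFold_crossLaplacian_mul_pow_map]
    refine mul_le_mul_of_nonneg_left ?_ (norm_nonneg _)
    refine (norm_kernel_map_le_of_entry_labels Mx _ m X' hB0 hM Adm hAdm).trans (mul_le_mul_of_nonneg_left (sum_le_sum fun σ _ => ?_) (pow_nonneg hB0 m))
    calc ∑ Y ∈ univ.filter (fun Y : Fin m → P × S => ∀ j, (Y j).2 = σ j), ‖kernel ℂ (dblFold ℂ
          ((grassmannLaplacian ℂ (crossCov ℂ (Mx.transpose * D * Mx)) ^ i * grassmannLaplacian ℂ (crossCov ℂ (Mx.transpose * g * Mx)))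
            (dblCopy ℂ 0 a' * dblCopy ℂ 1 b'))) m Y‖
        ≤ ∑ Y ∈ univ.filter (fun Y : Fin m → P × S => ∀ j, (Y j).2 = σ j), ∑ s : Fin m → Fin 2, K i s Y :=
          sum_le_sum fun Y _ => norm_kernel_dblFold_le _ m Y
      _ = ∑ s : Fin m → Fin 2, ∑ Y ∈ univ.filter (fun Y : Fin m → P × S => ∀ j, (Y j).2 = σ j), K i s Y := sum_comm
  -- (2) sum over `i`, exchange, pin, and bound by the tails
  rw [LinearMap.sum_apply, map_sum, map_sum, kernel_sum]
  refine (norm_sum_le _ _).trans ((sum_le_sum hterm).trans ?_)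
  have hex : ∑ i ∈ Sset, ‖c i‖ * (B ^ m * ∑ σ ∈ Fintype.piFinset (fun j => Adm (X' j)), ∑ s : Fin m → Fin 2,
      ∑ Y ∈ univ.filter (fun Y : Fin m → P × S => ∀ j, (Y j).2 = σ j), K i s Y) =
      B ^ m * ∑ σ ∈ Fintype.piFinset (fun j => Adm (X' j)), ∑ s : Fin m → Fin 2,
        ∑ Y ∈ univ.filter (fun Y : Fin m → P × S => ∀ j, (Y j).2 = σ j), ∑ i ∈ Sset, ‖c i‖ * K i s Y := by
    simp_rw [mul_sum]
    rw [sum_comm]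
    refine sum_congr rfl fun σ _ => ?_
    rw [sum_comm]
    refine sum_congr rfl fun s _ => ?_
    rw [sum_comm]
    refine sum_congr rfl fun Y _ => ?_
    refine sum_congr rfl fun i _ => ?_
    ring
  rw [hex]
  refine mul_le_mul_of_nonneg_left ?_ (pow_nonneg hB0 m)
  have hσ : ∀ σ ∈ Fintype.piFinset (fun j => Adm (X' j)), ∑ s : Fin m → Fin 2,
      ∑ Y ∈ univ.filter (fun Y : Fin m → P × S => ∀ j, (Y j).2 = σ j), ∑ i ∈ Sset, ‖c i‖ * K i s Y ≤ Fintype.card P * ∑ s : Fin m → Fin 2, T s := by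
    intro σ hσ
    rw [mul_sum]
    refine sum_le_sum fun s _ => sum_filter_labels_le_card_mul_of_pinned _ (fun Y => sum_nonneg fun i _ => mul_nonneg (norm_nonneg _) (hK0 i s Y))
      σ (p s) fun x => ?_
    rw [sum_comm]
    simp_rw [← mul_sum]
    exact hT s σ x (Fintype.mem_piFinset.1 hσ)
  calc ∑ σ ∈ Fintype.piFinset (fun j => Adm (X' j)), ∑ s : Fin m → Fin 2,
        ∑ Y ∈ univ.filter (fun Y : Fin m → P × S => ∀ j, (Y j).2 = σ j), ∑ i ∈ Sset, ‖c i‖ * K i s Y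
      ≤ ∑ _σ ∈ Fintype.piFinset (fun j => Adm (X' j)), (Fintype.card P * ∑ s : Fin m → Fin 2, T s) := sum_le_sum hσ
    _ = (∏ i, ((Adm (X' i)).card : ℝ)) * (Fintype.card P * ∑ s : Fin m → Fin 2, T s) := by
        rw [sum_const, Fintype.card_piFinset, nsmul_eq_mul, Nat.cast_prod]

end Pinned

end Summit.HubbardSuperconductivity.HubbardSuperconductivity.Theorems.KLRegimeWick

end
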